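import Summits.Ventures.HodgeRepro2.T5HeckeBasisCells
import Mathlib.Algebra.Polynomial.Div

/-!
# T5HeckePolynomialAlgebra — the algebra half of Satake, reduced to the leading-term property:
# an algebra with an `ℕ`-indexed basis `T₀ = 1, T₁, T₂, …` in which `T₁ · Tₙ ≡ T_{n+1}` modulo
# `span(T₀, …, Tₙ)` is the polynomial algebra `k[T₁]`

Tier-5 kernel support (seat p8, blind lane; sub-step N3).  T5-136 put the VECTOR-SPACE half of
the Satake isomorphism `H(U(2,1), K_U) ≅ ℂ[X^{±1}]^W` in kernel: the cells
`K_U diag(ϖ^k, 1, ϖ^{-k}) K_U`, `k ∈ ℕ`, give a basis `(T_k)` of the spherical Hecke algebra.  The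
ALGEBRA half — that `H(U(2,1), K_U)` is the polynomial algebra in the single generator `T₁` —
follows from ONE property of the structure constants, the leading-term property
`T₁ · T_n ∈ T_{n+1} + span(T₀, …, T_n)` (the top cell of `K a₁ K · K a_n K` is `K a_{n+1} K`,
with coefficient `1`).  This file proves the abstract statement:

* `aeval_injective` / `aeval_surjective` / `aeval_bijective` — for a `k`-subalgebra `A` (of any
  `k`-algebra `B`; the spherical Hecke algebra is a subalgebra of `End_k(k[G/K])`) with a basis
  `T : ℕ → A`, `T 0 = 1` and the leading-term property, `k[X] → A`, `X ↦ T 1` is bijective;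
* `nonempty_algEquiv_polynomial` — `k[X] ≃ₐ[k] A`; `mul_comm_of_leading` — such an `A` is
  commutative (a second route to T5-143's commutativity);
* `heckeBasisCells_zero` — `T₀ = 1` for T5-136's cell basis of `H(U(J₃(u)), K_U)` (the `0`-th cell
  is `K_U`);
* `heckeAlgebra_aeval_bijective` / `heckeAlgebra_nonempty_algEquiv_polynomial` — the
  instantiation: the spherical Hecke algebra IS `k[T₁]` provided the leading-term property of its
  cell basis (carried as the hypothesis `hlead`; the double-coset count itself stays prose);
  `heckeAlgebra_mul_comm_of_leading` — its commutativity from `hlead` alone.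

No `sorry`, no axiom beyond `propext`, `Classical.choice`, `Quot.sound`.
-/

namespace Summit.Ventures.HodgeRepro2.T5HeckePolynomialAlgebra

open Polynomial Submodule

section Abstract

variable {k : Type*} [Field k] {B : Type*} [Ring B] [Algebra k B] {A : Subalgebra k B}
  (T : Module.Basis ℕ k A)

/-- Left multiplication by `T 1` raises the filtration `span(T i, i < n)` by one step. -/
theorem mul_mem_span_of_leading
    (hlead : ∀ n, T 1 * T n - T (n + 1) ∈ span k (⇑T '' {i | i < n + 1}))
    {n : ℕ} {f : A} (hf : f ∈ span k (⇑T '' {i | i < n})) :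
    T 1 * f ∈ span k (⇑T '' {i | i < n + 1}) := by
  induction hf using Submodule.span_induction with
  | mem x hx =>
    obtain ⟨i, hi, rfl⟩ := hx
    have hi' : i < n := hi
    have h1 : T 1 * T i - T (i + 1) ∈ span k (⇑T '' {j | j < n + 1}) :=
      span_mono (Set.image_mono (fun j (hj : j < i + 1) => show j < n + 1 by omega)) (hlead i)
    have h2 : T (i + 1) ∈ span k (⇑T '' {j | j < n + 1}) :=
      subset_span ⟨i + 1, show i + 1 < n + 1 by omega, rfl⟩
    simpa using add_mem h1 h2
  | zero => simp
  | add x y _ _ hx hy => rw [mul_add]; exact add_mem hx hy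
  | smul a x _ hx => rw [mul_smul_comm]; exact smul_mem _ a hx

/-- **The leading-term lemma**: for `p` of degree `≤ n`, `p(T 1) ≡ (coeff p n) • T n` modulo
`span(T i, i < n)`. -/
theorem aeval_sub_smul_mem (hT0 : T 0 = 1)
    (hlead : ∀ n, T 1 * T n - T (n + 1) ∈ span k (⇑T '' {i | i < n + 1})) :
    ∀ (n : ℕ) (p : k[X]), p.natDegree ≤ n →
      aeval (T 1) p - p.coeff n • T n ∈ span k (⇑T '' {i | i < n}) := by
  intro n
  induction n with
  | zero =>
    intro p hp
    rw [eq_C_of_natDegree_le_zero hp, aeval_C, coeff_C_zero, hT0, Algebra.algebraMap_eq_smul_one,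
      sub_self]
    exact zero_mem _
  | succ n ih =>
    intro p hp
    have hq : p.divX.natDegree ≤ n := by
      rw [natDegree_divX_eq_natDegree_tsub_one]; omega
    have hf := ih p.divX hq
    have hp' : aeval (T 1) p = T 1 * aeval (T 1) p.divX + p.coeff 0 • (1 : A) := by
      conv_lhs => rw [← X_mul_divX_add p]
      rw [map_add, map_mul, aeval_X, aeval_C, Algebra.algebraMap_eq_smul_one]
    rw [coeff_divX] at hf
    have hg := hlead n
    have key : aeval (T 1) p - p.coeff (n + 1) • T (n + 1) =
        T 1 * (aeval (T 1) p.divX - p.coeff (n + 1) • T n) +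
          p.coeff (n + 1) • (T 1 * T n - T (n + 1)) + p.coeff 0 • T 0 := by
      rw [hp', hT0, mul_sub, mul_smul_comm, smul_sub]
      abel
    rw [key]
    refine add_mem (add_mem (mul_mem_span_of_leading T hlead hf) (smul_mem _ _ hg)) ?_
    exact smul_mem _ _ (subset_span ⟨0, show 0 < n + 1 by omega, rfl⟩)

/-- `k[X] → A`, `X ↦ T 1`, is injective. -/
theorem aeval_injective (hT0 : T 0 = 1)
    (hlead : ∀ n, T 1 * T n - T (n + 1) ∈ span k (⇑T '' {i | i < n + 1})) :
    Function.Injective (aeval (T 1) : k[X] →ₐ[k] A) := by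
  rw [injective_iff_map_eq_zero]
  intro p hp
  by_contra hne
  have h := aeval_sub_smul_mem T hT0 hlead p.natDegree p le_rfl
  rw [hp, zero_sub, neg_mem_iff] at h
  have hc : p.coeff p.natDegree ≠ 0 := by
    rwa [Ne, ← leadingCoeff, leadingCoeff_eq_zero]
  have hT : T p.natDegree ∈ span k (⇑T '' {i | i < p.natDegree}) := by
    have := smul_mem _ (p.coeff p.natDegree)⁻¹ h
    rwa [smul_smul, inv_mul_cancel₀ hc, one_smul] at this
  exact T.linearIndependent.notMem_span_image (show p.natDegree ∉ {i | i < p.natDegree} by simp) hT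

/-- Every basis vector lies in the image of `k[X] → A`. -/
theorem basis_mem_range (hT0 : T 0 = 1)
    (hlead : ∀ n, T 1 * T n - T (n + 1) ∈ span k (⇑T '' {i | i < n + 1})) (n : ℕ) :
    T n ∈ (aeval (T 1) : k[X] →ₐ[k] A).range := by
  induction n using Nat.strong_induction_on with
  | _ n ih =>
    cases n with
    | zero => rw [hT0]; exact Subalgebra.one_mem _
    | succ m =>
      have hspan : span k (⇑T '' {i | i < m + 1}) ≤
          Subalgebra.toSubmodule (aeval (T 1) : k[X] →ₐ[k] A).range := by
        rw [span_le]
        rintro _ ⟨i, hi, rfl⟩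
        exact ih i hi
      have hg : T 1 * T m - T (m + 1) ∈ (aeval (T 1) : k[X] →ₐ[k] A).range := hspan (hlead m)
      have h1 : T 1 ∈ (aeval (T 1) : k[X] →ₐ[k] A).range := ⟨X, aeval_X _⟩
      have hm : T m ∈ (aeval (T 1) : k[X] →ₐ[k] A).range := ih m (Nat.lt_succ_self m)
      have := Subalgebra.sub_mem _ (Subalgebra.mul_mem _ h1 hm) hg
      simpa using this

/-- `k[X] → A`, `X ↦ T 1`, is surjective. -/
theorem aeval_surjective (hT0 : T 0 = 1)
    (hlead : ∀ n, T 1 * T n - T (n + 1) ∈ span k (⇑T '' {i | i < n + 1})) :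
    Function.Surjective (aeval (T 1) : k[X] →ₐ[k] A) := by
  intro a
  have ha : a ∈ span k (Set.range ⇑T) := by rw [T.span_eq]; exact mem_top
  have hle : span k (Set.range ⇑T) ≤ Subalgebra.toSubmodule (aeval (T 1) : k[X] →ₐ[k] A).range := by
    rw [span_le]
    rintro _ ⟨n, rfl⟩
    exact basis_mem_range T hT0 hlead n
  exact hle ha

/-- **The algebra half of Satake, abstractly**: `k[X] → A`, `X ↦ T 1`, is bijective. -/
theorem aeval_bijective (hT0 : T 0 = 1)
    (hlead : ∀ n, T 1 * T n - T (n + 1) ∈ span k (⇑T '' {i | i < n + 1})) :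
    Function.Bijective (aeval (T 1) : k[X] →ₐ[k] A) :=
  ⟨aeval_injective T hT0 hlead, aeval_surjective T hT0 hlead⟩

/-- `A ≅ k[X]` as `k`-algebras. -/
theorem nonempty_algEquiv_polynomial (hT0 : T 0 = 1)
    (hlead : ∀ n, T 1 * T n - T (n + 1) ∈ span k (⇑T '' {i | i < n + 1})) :
    Nonempty (k[X] ≃ₐ[k] A) :=
  ⟨AlgEquiv.ofBijective _ (aeval_bijective T hT0 hlead)⟩

/-- Such an algebra is commutative (the image of the commutative `k[X]`). -/
theorem mul_comm_of_leading (hT0 : T 0 = 1)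
    (hlead : ∀ n, T 1 * T n - T (n + 1) ∈ span k (⇑T '' {i | i < n + 1})) (a b : A) :
    a * b = b * a := by
  obtain ⟨p, rfl⟩ := aeval_surjective T hT0 hlead a
  obtain ⟨q, rfl⟩ := aeval_surjective T hT0 hlead b
  rw [← map_mul, ← map_mul, mul_comm]

end Abstract

section Hecke

variable {R : Type*} {E : Type*} [CommRing R] [Field E] [StarRing E] [Algebra R E]
  [IsFractionRing R E] [IsDomain R] [IsDiscreteValuationRing R] [Finite (IsLocalRing.ResidueField R)]
  (hstar : ∀ x : E, IsLocalization.IsInteger R x → IsLocalization.IsInteger R (star x))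
  (u : E) (hsu : star u = u) (hu0 : u ≠ 0) (hu : IsLocalization.IsInteger R u)
  (hu' : IsLocalization.IsInteger R u⁻¹) {ϖ : R} (hϖ : Irreducible ϖ)
  (hs : star (algebraMap R E ϖ) = algebraMap R E ϖ) (k : Type*) [Field k]

omit [IsDomain R] [IsDiscreteValuationRing R] [Finite (IsLocalRing.ResidueField R)] in
/-- The `0`-th cell is the identity. -/
theorem cellU_zero : T5HeckeBasisCells.cellU hϖ hs u 0 = 1 := by
  apply Subtype.ext
  apply Units.ext
  ext i j
  simp only [T5HeckeBasisCells.cellU, T5CartanCellsDistinct.cell, T5CartanUniformiser.coe_diagonalUnit]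
  fin_cases i <;> fin_cases j <;> simp

/-- `T₀ = 1`: the `0`-th cell operator is the identity (T5-54's `doubleCosetOp_of_mem`). -/
theorem heckeBasisCells_zero :
    T5HeckeBasisCells.heckeBasisCells hstar u hsu hu0 hu hu' hϖ hs k 0 = 1 := by
  rw [T5HeckeBasisCells.heckeBasisCells_apply]
  apply T5HeckeDoubleCoset.doubleCosetOp_of_mem
  rw [cellU_zero]
  exact Subgroup.one_mem _

/-- **The spherical Hecke algebra `H(U(J₃(u)), K_U)` is the polynomial algebra `k[T₁]`** in the
first cell operator `T₁ = T_{K diag(ϖ, 1, ϖ⁻¹) K}`, provided its cell basis (T5-136) has the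
leading-term property `T₁ · T_n ∈ T_{n+1} + span(T₀, …, T_n)` (`hlead`; `T₀ = 1` is
`heckeBasisCells_zero`). -/
theorem heckeAlgebra_aeval_bijective
    (hlead : ∀ n, T5HeckeBasisCells.heckeBasisCells hstar u hsu hu0 hu hu' hϖ hs k 1 *
        T5HeckeBasisCells.heckeBasisCells hstar u hsu hu0 hu hu' hϖ hs k n -
        T5HeckeBasisCells.heckeBasisCells hstar u hsu hu0 hu hu' hϖ hs k (n + 1) ∈
      span k (⇑(T5HeckeBasisCells.heckeBasisCells hstar u hsu hu0 hu hu' hϖ hs k) '' {i | i < n + 1})) :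
    Function.Bijective
      (aeval (T5HeckeBasisCells.heckeBasisCells hstar u hsu hu0 hu hu' hϖ hs k 1) : k[X] →ₐ[k] _) :=
  aeval_bijective (T5HeckeBasisCells.heckeBasisCells hstar u hsu hu0 hu hu' hϖ hs k)
    (heckeBasisCells_zero hstar u hsu hu0 hu hu' hϖ hs k) hlead

/-- The same, as an algebra isomorphism `k[X] ≃ₐ[k] H(U(J₃(u)), K_U)`. -/
theorem heckeAlgebra_nonempty_algEquiv_polynomial
    (hlead : ∀ n, T5HeckeBasisCells.heckeBasisCells hstar u hsu hu0 hu hu' hϖ hs k 1 *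
        T5HeckeBasisCells.heckeBasisCells hstar u hsu hu0 hu hu' hϖ hs k n -
        T5HeckeBasisCells.heckeBasisCells hstar u hsu hu0 hu hu' hϖ hs k (n + 1) ∈
      span k (⇑(T5HeckeBasisCells.heckeBasisCells hstar u hsu hu0 hu hu' hϖ hs k) '' {i | i < n + 1})) :
    Nonempty (k[X] ≃ₐ[k] T5HeckePermutationModule.heckeAlgebra k
      (T5UnitaryHeckeAdjoint.hyperspecialSubgroup R (T5HermitianThreeElements.J3 u))) :=
  nonempty_algEquiv_polynomial (T5HeckeBasisCells.heckeBasisCells hstar u hsu hu0 hu hu' hϖ hs k)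
    (heckeBasisCells_zero hstar u hsu hu0 hu hu' hϖ hs k) hlead

/-- Commutativity of `H(U(J₃(u)), K_U)` from the leading-term property alone (a second route to
T5-127 / T5-143). -/
theorem heckeAlgebra_mul_comm_of_leading
    (hlead : ∀ n, T5HeckeBasisCells.heckeBasisCells hstar u hsu hu0 hu hu' hϖ hs k 1 *
        T5HeckeBasisCells.heckeBasisCells hstar u hsu hu0 hu hu' hϖ hs k n -
        T5HeckeBasisCells.heckeBasisCells hstar u hsu hu0 hu hu' hϖ hs k (n + 1) ∈
      span k (⇑(T5HeckeBasisCells.heckeBasisCells hstar u hsu hu0 hu hu' hϖ hs k) '' {i | i < n + 1}))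
    (a b : T5HeckePermutationModule.heckeAlgebra k
      (T5UnitaryHeckeAdjoint.hyperspecialSubgroup R (T5HermitianThreeElements.J3 u))) :
    a * b = b * a :=
  mul_comm_of_leading (T5HeckeBasisCells.heckeBasisCells hstar u hsu hu0 hu hu' hϖ hs k)
    (heckeBasisCells_zero hstar u hsu hu0 hu hu' hϖ hs k) hlead a b

end Hecke

end Summit.Ventures.HodgeRepro2.T5HeckePolynomialAlgebra
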